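import Summits.ValiantsHypothesis.ValiantsHypothesis.Theorems.LacunarySymmetroidMatrixDescartesCensusIntervalParityVisits
import Summits.ValiantsHypothesis.ValiantsHypothesis.Theorems.LacunarySymmetroidMatrixDescartesCensusDoorA34NodeChambersComplex

/-!
# `MatrixDescartes` census — class R2: the WALL LAW and the PARITY RULE between zeros of the two real node nomials

HONEST FRAMING.  Object-search cell `pub-symmetroid`, door-A seat `val-sym-door-p3` (g9); item stmt-ValiantsHypothesis-19980
`DoorA34 = PosRootLawAt 3 4 18` (route item `Theses.LacunarySymmetroid.DoorA34`) is OPEN and asserted nowhere in this file.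
Class-R2 companion of `…CensusIntervalParityWalls/Visits/Monotone` (class R4).  In class R2 (two real nodes `v₀, v₁`, one
conjugate pair `r ± is`) only the two REAL node nomials `ℓ₀, ℓ₁` have walls (the pair coefficient `m = m_R + i m_I` does not vanish
generically), and `…NodeChambersComplex.det_R2_eq` gives the value of the determinant ON a wall:

* `det_R2_wall₀` / `det_R2_wall₁` — at a zero of `ℓ₀`: `det M = −(m_R² + m_I²)·D₁²·ℓ₁`; at a zero of `ℓ₁`: `det M = −(m_R²+m_I²)·D₀²·ℓ₀`.
  So (with `m ≠ 0`, `Dᵢ ≠ 0`, the other real node nomial non-zero) NO det-root lies on a wall, and the sign of `det` there is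
  the OPPOSITE of the sign of the other real node nomial.
* **`even_countP_roots_R2_sameNode`** — between two zeros `t₁ < t₂` of `ℓ₀` with `ℓ₁` zero-free on `[t₁,t₂]` and `m(t₁), m(t₂) ≠ 0`,
  the pencil `S l = A 0 l • v₀v₀ᵀ + A 1 l • v₁v₁ᵀ + A 2 l • (rrᵀ − ssᵀ) − A 3 l • (rsᵀ + srᵀ)` has an EVEN number of det-roots in
  `(t₁,t₂)` counted with multiplicity (return visits are even, class R2);
* **`even_countP_roots_R2_iff`** — between a zero `t₁` of `ℓ₀` and a zero `t₂ > t₁` of `ℓ₁` (`ℓ₁(t₁), ℓ₀(t₂) ≠ 0`, `m ≠ 0` at both):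
  Even ↔ `0 < ℓ₁(t₁) · ℓ₀(t₂)` (monotone visits are odd).

Nothing here bounds `ζ_sym(3,4)`; `DoorA34` stays OPEN; nothing bears on `MatrixDescartes` (stmt-ValiantsHypothesis-18050) or on
`VP ≠ VNP`.  [folklore] Interval parity + the R2 determinant identity.
-/

-- `Summit.ValiantsHypothesis.ValiantsHypothesis.…` repeats a component by the D-0017 layout
-- (single-conjunct summit), which the `dupNamespace` linter flags; the name is mandated.
set_option linter.dupNamespace false

namespace Summit.ValiantsHypothesis.ValiantsHypothesis.Theorems.LacunarySymmetroidMatrixDescartes.Census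

open Finset Polynomial
open scoped BigOperators Matrix Polynomial
open Summit.ValiantsHypothesis.ValiantsHypothesis.Theorems.SymmetroidDescartes (eval_det_pencil)

/-- **R2 wall law (wall of `ℓ₀`).**  `det (0·v₀v₀ᵀ + ℓ₁ v₁v₁ᵀ + m_R(rrᵀ−ssᵀ) − m_I(rsᵀ+srᵀ)) = −(m_R²+m_I²)·D₁²·ℓ₁`, `D₁ = det(v₁;r;s)`. [folklore] -/
theorem det_R2_wall₀ (v₀ v₁ r s : Fin 3 → ℝ) (ℓ₁ mR mI : ℝ) :
    ((0 : ℝ) • Matrix.vecMulVec v₀ v₀ + ℓ₁ • Matrix.vecMulVec v₁ v₁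
        + mR • (Matrix.vecMulVec r r - Matrix.vecMulVec s s) - mI • (Matrix.vecMulVec r s + Matrix.vecMulVec s r)).det
      = -(mR ^ 2 + mI ^ 2) *
          ((v₁ 0 * (r 1 * s 2 - r 2 * s 1) - v₁ 1 * (r 0 * s 2 - r 2 * s 0) + v₁ 2 * (r 0 * s 1 - r 1 * s 0)) ^ 2 * ℓ₁) := by
  rw [det_R2_eq]; ring

/-- **R2 wall law (wall of `ℓ₁`).** [folklore] -/
theorem det_R2_wall₁ (v₀ v₁ r s : Fin 3 → ℝ) (ℓ₀ mR mI : ℝ) :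
    (ℓ₀ • Matrix.vecMulVec v₀ v₀ + (0 : ℝ) • Matrix.vecMulVec v₁ v₁
        + mR • (Matrix.vecMulVec r r - Matrix.vecMulVec s s) - mI • (Matrix.vecMulVec r s + Matrix.vecMulVec s r)).det
      = -(mR ^ 2 + mI ^ 2) *
          ((v₀ 0 * (r 1 * s 2 - r 2 * s 1) - v₀ 1 * (r 0 * s 2 - r 2 * s 0) + v₀ 2 * (r 0 * s 1 - r 1 * s 0)) ^ 2 * ℓ₀) := by
  rw [det_R2_eq]; ring

/-- The R2 pencil (letters `A 0 l • v₀v₀ᵀ + A 1 l • v₁v₁ᵀ + A 2 l • (rrᵀ−ssᵀ) − A 3 l • (rsᵀ+srᵀ)`) evaluated at `t` is the R2 matrix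
with node values `ℓ₀(t), ℓ₁(t), m_R(t), m_I(t)` (`= ∑ₗ A i l t^(d l)`). [folklore] -/
theorem eval_det_pencil_R2 {K : ℕ} (d : Fin K → ℕ) (A : Fin 4 → Fin K → ℝ) (v₀ v₁ r s : Fin 3 → ℝ) (t : ℝ) :
    ((∑ l, (X : ℝ[X]) ^ d l • (A 0 l • Matrix.vecMulVec v₀ v₀ + A 1 l • Matrix.vecMulVec v₁ v₁
        + A 2 l • (Matrix.vecMulVec r r - Matrix.vecMulVec s s)
        - A 3 l • (Matrix.vecMulVec r s + Matrix.vecMulVec s r)).map C).det).eval t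
      = ((∑ l, A 0 l * t ^ d l) • Matrix.vecMulVec v₀ v₀ + (∑ l, A 1 l * t ^ d l) • Matrix.vecMulVec v₁ v₁
          + (∑ l, A 2 l * t ^ d l) • (Matrix.vecMulVec r r - Matrix.vecMulVec s s)
          - (∑ l, A 3 l * t ^ d l) • (Matrix.vecMulVec r s + Matrix.vecMulVec s r)).det := by
  rw [eval_det_pencil]
  congr 1
  ext a b
  simp only [Matrix.sum_apply, Matrix.smul_apply, Matrix.add_apply, Matrix.sub_apply, Matrix.vecMulVec_apply, smul_eq_mul,
    Finset.sum_mul, ← Finset.sum_add_distrib, ← Finset.sum_sub_distrib]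
  exact Finset.sum_congr rfl fun l _ => by ring

/-- **RETURN VISITS ARE EVEN, class R2.**  Between two zeros `t₁ < t₂` of the real node nomial `ℓ₀`, with `ℓ₁` zero-free on
`[t₁, t₂]`, `D₁ = det(v₁;r;s) ≠ 0` and the pair coefficient non-zero at `t₁` and `t₂`, the R2 pencil has an even number of
det-roots in `(t₁,t₂)` counted with multiplicity. [folklore] -/
theorem even_countP_roots_R2_sameNode {K : ℕ} (d : Fin K → ℕ) (A : Fin 4 → Fin K → ℝ) (v₀ v₁ r s : Fin 3 → ℝ)
    (hD₁ : v₁ 0 * (r 1 * s 2 - r 2 * s 1) - v₁ 1 * (r 0 * s 2 - r 2 * s 0) + v₁ 2 * (r 0 * s 1 - r 1 * s 0) ≠ 0)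
    {t₁ t₂ : ℝ} (ht : t₁ < t₂)
    (h₁ : ∑ l, A 0 l * t₁ ^ d l = 0) (h₂ : ∑ l, A 0 l * t₂ ^ d l = 0)
    (hℓ₁ : ∀ t ∈ Set.Icc t₁ t₂, ∑ l, A 1 l * t ^ d l ≠ 0)
    (hm₁ : 0 < (∑ l, A 2 l * t₁ ^ d l) ^ 2 + (∑ l, A 3 l * t₁ ^ d l) ^ 2)
    (hm₂ : 0 < (∑ l, A 2 l * t₂ ^ d l) ^ 2 + (∑ l, A 3 l * t₂ ^ d l) ^ 2)
    (hP : (∑ l, (X : ℝ[X]) ^ d l • (A 0 l • Matrix.vecMulVec v₀ v₀ + A 1 l • Matrix.vecMulVec v₁ v₁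
        + A 2 l • (Matrix.vecMulVec r r - Matrix.vecMulVec s s)
        - A 3 l • (Matrix.vecMulVec r s + Matrix.vecMulVec s r)).map C).det ≠ 0) :
    Even ((∑ l, (X : ℝ[X]) ^ d l • (A 0 l • Matrix.vecMulVec v₀ v₀ + A 1 l • Matrix.vecMulVec v₁ v₁
        + A 2 l • (Matrix.vecMulVec r r - Matrix.vecMulVec s s)
        - A 3 l • (Matrix.vecMulVec r s + Matrix.vecMulVec s r)).map C).det.roots.countP (fun x => t₁ < x ∧ x < t₂)) := by
  set P := (∑ l, (X : ℝ[X]) ^ d l • (A 0 l • Matrix.vecMulVec v₀ v₀ + A 1 l • Matrix.vecMulVec v₁ v₁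
        + A 2 l • (Matrix.vecMulVec r r - Matrix.vecMulVec s s)
        - A 3 l • (Matrix.vecMulVec r s + Matrix.vecMulVec s r)).map C).det with hPdef
  set D₁ := v₁ 0 * (r 1 * s 2 - r 2 * s 1) - v₁ 1 * (r 0 * s 2 - r 2 * s 0) + v₁ 2 * (r 0 * s 1 - r 1 * s 0) with hD₁def
  have hw : ∀ t, ∑ l, A 0 l * t ^ d l = 0 → P.eval t =
      -((∑ l, A 2 l * t ^ d l) ^ 2 + (∑ l, A 3 l * t ^ d l) ^ 2) * (D₁ ^ 2 * ∑ l, A 1 l * t ^ d l) := by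
    intro t h0
    rw [hPdef, eval_det_pencil_R2, h0, det_R2_wall₀]
  have e1 := hw t₁ h₁
  have e2 := hw t₂ h₂
  have hne1 : P.eval t₁ ≠ 0 := by
    rw [e1]; exact mul_ne_zero (neg_ne_zero.mpr hm₁.ne') (mul_ne_zero (pow_ne_zero 2 hD₁) (hℓ₁ t₁ ⟨le_rfl, ht.le⟩))
  have hne2 : P.eval t₂ ≠ 0 := by
    rw [e2]; exact mul_ne_zero (neg_ne_zero.mpr hm₂.ne') (mul_ne_zero (pow_ne_zero 2 hD₁) (hℓ₁ t₂ ⟨ht.le, le_rfl⟩))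
  rw [even_countP_roots_Ioo_iff' P hP ht hne1 hne2, e1, e2]
  have pers := mul_pos_of_forall_ne_zero (continuous_nodeNomial d A 1) ht hℓ₁
  have hD : 0 < (D₁ ^ 2) ^ 2 := by positivity
  have key : -((∑ l, A 2 l * t₁ ^ d l) ^ 2 + (∑ l, A 3 l * t₁ ^ d l) ^ 2) * (D₁ ^ 2 * ∑ l, A 1 l * t₁ ^ d l) *
        (-((∑ l, A 2 l * t₂ ^ d l) ^ 2 + (∑ l, A 3 l * t₂ ^ d l) ^ 2) * (D₁ ^ 2 * ∑ l, A 1 l * t₂ ^ d l))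
      = (((∑ l, A 2 l * t₁ ^ d l) ^ 2 + (∑ l, A 3 l * t₁ ^ d l) ^ 2) *
          ((∑ l, A 2 l * t₂ ^ d l) ^ 2 + (∑ l, A 3 l * t₂ ^ d l) ^ 2) * (D₁ ^ 2) ^ 2) *
        ((∑ l, A 1 l * t₁ ^ d l) * (∑ l, A 1 l * t₂ ^ d l)) := by ring
  rw [key]
  exact mul_pos (mul_pos (mul_pos hm₁ hm₂) hD) pers

/-- **MONOTONE VISITS, class R2.**  Between a zero `t₁` of `ℓ₀` and a zero `t₂ > t₁` of `ℓ₁` (with `ℓ₁(t₁), ℓ₀(t₂) ≠ 0`,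
`D₀, D₁ ≠ 0`, pair coefficient non-zero at both), the number of det-roots of the R2 pencil in `(t₁,t₂)` counted with multiplicity is
even iff `ℓ₁(t₁) · ℓ₀(t₂) > 0`. [folklore] -/
theorem even_countP_roots_R2_iff {K : ℕ} (d : Fin K → ℕ) (A : Fin 4 → Fin K → ℝ) (v₀ v₁ r s : Fin 3 → ℝ)
    (hD₀ : v₀ 0 * (r 1 * s 2 - r 2 * s 1) - v₀ 1 * (r 0 * s 2 - r 2 * s 0) + v₀ 2 * (r 0 * s 1 - r 1 * s 0) ≠ 0)
    (hD₁ : v₁ 0 * (r 1 * s 2 - r 2 * s 1) - v₁ 1 * (r 0 * s 2 - r 2 * s 0) + v₁ 2 * (r 0 * s 1 - r 1 * s 0) ≠ 0)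
    {t₁ t₂ : ℝ} (ht : t₁ < t₂)
    (h₁ : ∑ l, A 0 l * t₁ ^ d l = 0) (h₂ : ∑ l, A 1 l * t₂ ^ d l = 0)
    (h₁' : ∑ l, A 1 l * t₁ ^ d l ≠ 0) (h₂' : ∑ l, A 0 l * t₂ ^ d l ≠ 0)
    (hm₁ : 0 < (∑ l, A 2 l * t₁ ^ d l) ^ 2 + (∑ l, A 3 l * t₁ ^ d l) ^ 2)
    (hm₂ : 0 < (∑ l, A 2 l * t₂ ^ d l) ^ 2 + (∑ l, A 3 l * t₂ ^ d l) ^ 2)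
    (hP : (∑ l, (X : ℝ[X]) ^ d l • (A 0 l • Matrix.vecMulVec v₀ v₀ + A 1 l • Matrix.vecMulVec v₁ v₁
        + A 2 l • (Matrix.vecMulVec r r - Matrix.vecMulVec s s)
        - A 3 l • (Matrix.vecMulVec r s + Matrix.vecMulVec s r)).map C).det ≠ 0) :
    Even ((∑ l, (X : ℝ[X]) ^ d l • (A 0 l • Matrix.vecMulVec v₀ v₀ + A 1 l • Matrix.vecMulVec v₁ v₁
        + A 2 l • (Matrix.vecMulVec r r - Matrix.vecMulVec s s)
        - A 3 l • (Matrix.vecMulVec r s + Matrix.vecMulVec s r)).map C).det.roots.countP (fun x => t₁ < x ∧ x < t₂)) ↔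
      0 < (∑ l, A 1 l * t₁ ^ d l) * (∑ l, A 0 l * t₂ ^ d l) := by
  set P := (∑ l, (X : ℝ[X]) ^ d l • (A 0 l • Matrix.vecMulVec v₀ v₀ + A 1 l • Matrix.vecMulVec v₁ v₁
        + A 2 l • (Matrix.vecMulVec r r - Matrix.vecMulVec s s)
        - A 3 l • (Matrix.vecMulVec r s + Matrix.vecMulVec s r)).map C).det with hPdef
  set D₀ := v₀ 0 * (r 1 * s 2 - r 2 * s 1) - v₀ 1 * (r 0 * s 2 - r 2 * s 0) + v₀ 2 * (r 0 * s 1 - r 1 * s 0) with hD₀def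
  set D₁ := v₁ 0 * (r 1 * s 2 - r 2 * s 1) - v₁ 1 * (r 0 * s 2 - r 2 * s 0) + v₁ 2 * (r 0 * s 1 - r 1 * s 0) with hD₁def
  have e1 : P.eval t₁ = -((∑ l, A 2 l * t₁ ^ d l) ^ 2 + (∑ l, A 3 l * t₁ ^ d l) ^ 2) * (D₁ ^ 2 * ∑ l, A 1 l * t₁ ^ d l) := by
    rw [hPdef, eval_det_pencil_R2, h₁, det_R2_wall₀]
  have e2 : P.eval t₂ = -((∑ l, A 2 l * t₂ ^ d l) ^ 2 + (∑ l, A 3 l * t₂ ^ d l) ^ 2) * (D₀ ^ 2 * ∑ l, A 0 l * t₂ ^ d l) := by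
    rw [hPdef, eval_det_pencil_R2, h₂, det_R2_wall₁]
  have hne1 : P.eval t₁ ≠ 0 := by
    rw [e1]; exact mul_ne_zero (neg_ne_zero.mpr hm₁.ne') (mul_ne_zero (pow_ne_zero 2 hD₁) h₁')
  have hne2 : P.eval t₂ ≠ 0 := by
    rw [e2]; exact mul_ne_zero (neg_ne_zero.mpr hm₂.ne') (mul_ne_zero (pow_ne_zero 2 hD₀) h₂')
  rw [even_countP_roots_Ioo_iff' P hP ht hne1 hne2, e1, e2]
  have hc : 0 < ((∑ l, A 2 l * t₁ ^ d l) ^ 2 + (∑ l, A 3 l * t₁ ^ d l) ^ 2) *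
      ((∑ l, A 2 l * t₂ ^ d l) ^ 2 + (∑ l, A 3 l * t₂ ^ d l) ^ 2) * (D₁ ^ 2 * D₀ ^ 2) :=
    mul_pos (mul_pos hm₁ hm₂) (mul_pos (by positivity) (by positivity))
  have key : -((∑ l, A 2 l * t₁ ^ d l) ^ 2 + (∑ l, A 3 l * t₁ ^ d l) ^ 2) * (D₁ ^ 2 * ∑ l, A 1 l * t₁ ^ d l) *
        (-((∑ l, A 2 l * t₂ ^ d l) ^ 2 + (∑ l, A 3 l * t₂ ^ d l) ^ 2) * (D₀ ^ 2 * ∑ l, A 0 l * t₂ ^ d l))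
      = ((∑ l, A 1 l * t₁ ^ d l) * (∑ l, A 0 l * t₂ ^ d l)) *
        (((∑ l, A 2 l * t₁ ^ d l) ^ 2 + (∑ l, A 3 l * t₁ ^ d l) ^ 2) *
          ((∑ l, A 2 l * t₂ ^ d l) ^ 2 + (∑ l, A 3 l * t₂ ^ d l) ^ 2) * (D₁ ^ 2 * D₀ ^ 2)) := by ring
  rw [key, mul_pos_iff_of_pos_right hc]

end Summit.ValiantsHypothesis.ValiantsHypothesis.Theorems.LacunarySymmetroidMatrixDescartes.Census
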